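import Summits.ABC.ABC.Theorems.IsogenyGlueCongruenceEllipticGluingPrimeBoundSlicesOfBound
import Literature.AlgebraicGeometry.Motives.AbelianVarietyEndGaloisDescent
import Literature.NumberTheory.GaloisRepresentations.AbsGaloisGroup
import HarnessLib

/-!
# Crux U `EllipticGluingPrimeBound` (stmt-ABC-13919), line `SketchIdeator5` — the `d = 1` shadow
# of the CM residual R_cm: fixed-curve torsion sharing for CM curves

Line `SketchIdeator5` reduces the crux U to two residual open statements; the CM one, R_cm
(`stub_cmCurvePartnerBound`), says: for CM curves `W/ℚ` with abelian-variety model `(E, e)`,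
ℚ-simple partners `A` geometrically free of `E` (`Hom(E_ℚ̄, A_ℚ̄) = 0`), and primes `ℓ` with
`W[ℓ]` irreducible, a `Γ_ℚ`-equivariant embedding `W[ℓ] ↪ A(ℚ̄)` forces
`ℓ ≤ C · ((dim A + 1) · max(1, h_F W))^κ`.

This file records the `d = 1` SHADOW of R_cm, its formal hardness certificate (provable now, by
specialisation): R_cm implies that for a CM curve `W` the primes `ℓ` of irreducible `W[ℓ]` at
which `W` shares its `ℓ`-torsion with a geometrically NON-isogenous elliptic partner `W'` are
bounded by `C · max(1, h_F(W))^κ` — uniformly in `W'` (a Serre-uniformity-shaped statement: the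
bound sees the CM curve `W` only, the partner's height and conductor being arbitrary).

* `cmFixedCurveSharing_of_cmCurvePartnerBound` — **R_cm ⟹** there are absolute `κ ≥ 0`, `C` with
  `ℓ ≤ C · max(1, h_F(W))^κ` for every such `(W, W', ℓ)` carrying a `Γ_ℚ`-equivariant injection
  `W[ℓ] ↪ W'(ℚ̄)`.

Proof: specialise R_cm to `A :=` the abelian-variety model of `W'`: `dim A = 1`
(`dim_eq_one_of_equiv`), so `A` is ℚ-simple (`AbelianVariety.isSimple_of_dim_le_one`); transport
the embedding along `e'⁻¹ : W'(ℚ̄) ≃ A(ℚ̄)`; apply R_cm (threading `W.HasCM` through) and absorb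
`(1 + 1)^κ = 2^κ` into the constant (`C' = max C 0 · 2^κ`) — verbatim the steps of
`fixedCurveTorsionSharing_of_ellipticGluingPrimeBound`
(`IsogenyGlueCongruenceEllipticGluingPrimeBoundFixedCurveSlice`). Unconditional; no new
definitions; no named facts; no `sorry`; lands `--supports stmt-ABC-13919`.
-/

noncomputable section

-- `Summit.<Summit>.<Problem>` is the mandated summit-side namespace (CONVENTIONS §2); for the
-- single-conjunct summit `ABC` the two coincide, so the duplicate `ABC.ABC` is deliberate.
set_option linter.dupNamespace false

namespace Summit.ABC.ABC.Theorems.GluingSlices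

open CategoryTheory CategoryTheory.Limits AlgebraicGeometry
open Literature.AlgebraicGeometry.Motives
open Summit.ABC.ABC.Theses.IsogenyGlueCongruence
open Summit.ABC.ABC.Theorems.IsotypicMinkowski

/-- **R_cm ⟹ fixed-curve torsion sharing for CM curves, uniform in the partner curve (the
`d = 1` shadow / hardness certificate of the CM residual R_cm of line `SketchIdeator5`).**
If R_cm (`stub_cmCurvePartnerBound`) holds then there are absolute `κ ≥ 0`, `C` such that for all
elliptic `W, W'/ℚ` with abelian-variety models `(E, e)`, `(A, e')` (equivariant identifications of
`ℚ̄`-points), `Hom(E_ℚ̄, A_ℚ̄) = 0` (the partner `W'` is not geometrically isogenous to `W`), `W`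
with CM, and every prime `ℓ` with `W[ℓ]` irreducible admitting a `Γ_ℚ`-equivariant injection
`W[ℓ] ↪ W'(ℚ̄)`: `ℓ ≤ C · max(1, h_F(W))^κ` — for a CM curve `W` the primes of irreducible torsion
sharing with geometrically non-isogenous elliptic partners `W'` are bounded uniformly in `W'`
(Serre-uniformity shape). `dim A = 1` makes `A` ℚ-simple, the embedding is transported along
`e'⁻¹`, and `(dim A + 1)^κ = 2^κ` is absorbed into the constant. -/
theorem cmFixedCurveSharing_of_cmCurvePartnerBound :
    (∃ κ C : ℝ, 0 ≤ κ ∧ ∀ (W : WeierstrassCurve ℚ) [W.IsElliptic] (E A : AbelianVariety.{0} ℚ)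
      (e : E.geomPoints ≃+ W.geomPoints),
      (∀ (σ : Field.absoluteGaloisGroup ℚ) (P : E.geomPoints), e (σ • P) = σ • e P) →
      (∀ f : E.baseChange (AlgebraicClosure ℚ) ⟶ A.baseChange (AlgebraicClosure ℚ), f = 0) →
      AbelianVariety.IsSimple A →
      ∀ ℓ : ℕ, ℓ.Prime → W.HasIrreducibleModPGaloisRep ℓ → W.HasCM →
      (∃ ι : W.geomTorsion ℓ →+ A.geomPoints, Function.Injective ι ∧
        ∀ (σ : Field.absoluteGaloisGroup ℚ) (P : W.geomTorsion ℓ), ι (σ • P) = σ • ι P) →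
        (ℓ : ℝ) ≤ C * (((A.dim : ℝ) + 1) * max 1 W.stableFaltingsHeight) ^ κ) →
    ∃ κ C : ℝ, 0 ≤ κ ∧ ∀ (W W' : WeierstrassCurve ℚ) [W.IsElliptic] [W'.IsElliptic]
      (E A : AbelianVariety.{0} ℚ) (e : E.geomPoints ≃+ W.geomPoints)
      (e' : A.geomPoints ≃+ W'.geomPoints),
      (∀ (σ : Field.absoluteGaloisGroup ℚ) (P : E.geomPoints), e (σ • P) = σ • e P) →
      (∀ (σ : Field.absoluteGaloisGroup ℚ) (P : A.geomPoints), e' (σ • P) = σ • e' P) →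
      (∀ f : E.baseChange (AlgebraicClosure ℚ) ⟶ A.baseChange (AlgebraicClosure ℚ), f = 0) →
      W.HasCM → ∀ ℓ : ℕ, ℓ.Prime → W.HasIrreducibleModPGaloisRep ℓ →
      (∃ ι : W.geomTorsion ℓ →+ W'.geomPoints, Function.Injective ι ∧
        ∀ (σ : Field.absoluteGaloisGroup ℚ) (P : W.geomTorsion ℓ), ι (σ • P) = σ • ι P) →
        (ℓ : ℝ) ≤ C * (max 1 W.stableFaltingsHeight) ^ κ := by
  intro hR
  obtain ⟨κ, C, hκ, h⟩ := hR
  refine ⟨κ, max C 0 * (2 : ℝ) ^ κ, hκ, ?_⟩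
  intro W W' _ _ E A e e' he he' hfree hCM ℓ hℓ hirr hι
  obtain ⟨ι, hinj, hιeq⟩ := hι
  -- (2) transport the embedding along `e'⁻¹ : W'(ℚ̄) ≃ A(ℚ̄)`
  have he'symm : ∀ (σ : Field.absoluteGaloisGroup ℚ) (Q : W'.geomPoints),
      e'.symm (σ • Q) = σ • e'.symm Q := by
    intro σ Q
    apply e'.injective
    rw [he', e'.apply_symm_apply, e'.apply_symm_apply]
  let ι' : W.geomTorsion ℓ →+ A.geomPoints := (e'.symm : W'.geomPoints →+ A.geomPoints).comp ι
  have hι' : ∃ ι' : W.geomTorsion ℓ →+ A.geomPoints, Function.Injective ι' ∧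
      ∀ (σ : Field.absoluteGaloisGroup ℚ) (P : W.geomTorsion ℓ), ι' (σ • P) = σ • ι' P := by
    refine ⟨ι', e'.symm.injective.comp hinj, fun σ P ↦ ?_⟩
    show e'.symm (ι (σ • P)) = σ • e'.symm (ι P)
    rw [hιeq, he'symm]
  -- (1) `dim A = 1`, so `A` is ℚ-simple
  have hA1 : A.dim = 1 := dim_eq_one_of_equiv e'
  have hsimple : AbelianVariety.IsSimple A := AbelianVariety.isSimple_of_dim_le_one hA1.le
  have hbound := h W E A e he hfree hsimple ℓ hℓ hirr hCM hι'
  -- (3) absorb `(dim A + 1)^κ = 2^κ` into the constant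
  set m : ℝ := max 1 W.stableFaltingsHeight with hm
  have hm1 : (1 : ℝ) ≤ m := le_max_left _ _
  have hm0 : (0 : ℝ) ≤ m := zero_le_one.trans hm1
  have hdim : ((A.dim : ℝ) + 1) = 2 := by rw [hA1]; norm_num
  rw [hdim] at hbound
  have hsplit : ((2 : ℝ) * m) ^ κ = (2 : ℝ) ^ κ * m ^ κ := Real.mul_rpow (by norm_num) hm0
  calc (ℓ : ℝ) ≤ C * ((2 : ℝ) * m) ^ κ := hbound
    _ ≤ max C 0 * ((2 : ℝ) * m) ^ κ :=
        mul_le_mul_of_nonneg_right (le_max_left _ _) (Real.rpow_nonneg (by positivity) κ)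
    _ = max C 0 * (2 : ℝ) ^ κ * m ^ κ := by rw [hsplit, mul_assoc]

end Summit.ABC.ABC.Theorems.GluingSlices

end
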